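/-
Copyright (c) 2026. All rights reserved.
Released under Apache 2.0 license as described in the file LICENSE.
-/
import Literature.Probability.FitznerVanDerHofstad2017.NobleBoundsN1Class00
import Literature.Probability.FitznerVanDerHofstad2017.NobleBoundsN1Class01
import Literature.Probability.FitznerVanDerHofstad2017.NobleBoundsN1Class10
import Literature.Probability.FitznerVanDerHofstad2017.NobleBoundsN1Class12
import Literature.Probability.FitznerVanDerHofstad2017.NobleBoundsN1Class20
import Literature.Probability.FitznerVanDerHofstad2017.NobleBoundsN1Cls02
import Literature.Probability.FitznerVanDerHofstad2017.NobleBoundsN1Cls11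
import Literature.Probability.FitznerVanDerHofstad2017.NobleBoundsN1Cls21
import Literature.Probability.FitznerVanDerHofstad2017.NobleBoundsN1Cls22
import Literature.Probability.FitznerVanDerHofstad2017.NobleBlocksPrime
import HarnessLib

/-!
# Fitzner–van der Hofstad (2017), §6.1 — the `x`-space bound (6.4) on `Ξ^{(1)}` and its sum (6.5)

[FvdH17] = R. Fitzner, R. van der Hofstad, *Mean-field behavior for nearest-neighbor percolation in `d > 10`*,
Electron. J. Probab. **22** (2017), no. 43, arXiv:1506.07977v2.

§6.1 (v2 p. 58), (6.4): "`Ξ^{(1)}_p(x) ≤ Σ_{u,ι,w,z,t} Σ_{a,b} P^{S,a}(u,w) Ā^{ι,a,b}(u,w,t,z) P^{E,b}(t−x,z−x)`"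
and (6.5): "`Σ_x Ξ^{(1)}_p(x) ≤ P⃗^S Ā^ι P⃗^E`" (Lemma 5.2, first display).

This module is the ASSEMBLY ONLY: the joint two-level bounding event (`NobleJointTwoLevel`, (4.65) kept as one
event on `ℙ_p ⊗ ℙ_p`), the splitting into the nine classes `(a,b) ∈ {0,1,2}²` of the first and last line and the
`[0,∞]` bookkeeping (`NobleBoundsN1Classes.nobleXiT_one_le_blocks_of_cls`), and the nine class estimates
(`NobleBoundsN1Class00/01/10/12/20`, `NobleBoundsN1Cls02/11/21/22` — each
`J(v−u) ℙ_p^{⊗2}(jointWit(u,v,w,z,t;x) ∩ class (a,b)) ≤ Σ_ι 𝟙{v = u+e_ι} P^{S,a}(u,w) Ā'^{ι,a,b}(u,w,t,z) P^{E,b}(t−x,z−x)`)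
are combined into (6.4), written with the primed middle element `Ā' = blockAbar'` of `NobleBlocksPrime` (the
`(a,c) = (0,0)` row corrected as documented there; all other rows are the printed `Ā`), and summed over `x` into
(6.5) on `(Ā^ι)' = matAbarIota'` by `NobleBlocksPrime.tsum_le_vecPS_matAbarIota'_vecPE`.

No named fact, no numeral, no dimension is fixed; nothing here is a cited hypothesis.
-/

noncomputable section

namespace Literature.Probability.FitznerVanDerHofstad2017

open _root_.MeasureTheory Literature.Barriers.CriticalPhenomena Literature.Probability.Percolation
open Literature.Probability.LatticeModels _root_.SimpleGraph
open Literature.Probability.FitznerVanDerHofstad2017.NobleBlocks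
open scoped ENNReal Matrix

variable {d : ℕ}

/-- **[FvdH17] (6.4), the `x`-space bound on `Ξ^{(1)}_p(x)`** (bond percolation on `ℤ^d`, every `p`, every `x`):
`Ξ^{(1)}_p(x) ≤ Σ_{u,w,t,z} Σ_{ι,a,b} P^{S,a}(u,w) Ā'^{ι,a,b}(u,w,t,z) P^{E,b}(t−x,z−x)` — the joint two-level event,
split into the nine classes of §6.1, each class bounded by its class module.
[cite: FitznerVanDerHofstad2017, §6.1 (6.4) with "Case a = 0 / a = 1 / a ≥ 2" and "b" likewise (arXiv:1506.07977v2 pp. 58–59)] -/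
theorem nobleXiT_one_le_blocks (p : unitInterval) (x : Site d) :
    nobleXiT d p 1 x ≤ ∑' u, ∑' w, ∑' t, ∑' z, ∑ ι : Fin d × Bool, ∑ a : Fin 3, ∑ b : Fin 3,
      blockPS (Letters.perc d p) a u w * blockAbar' (Letters.perc d p) ι a b u w t z *
        blockPE (Letters.perc d p) b (t - x) (z - x) := by
  refine nobleXiT_one_le_blocks_of_cls (Letters.perc d p) p x (fun u v w z t => jointWit u v w z t x)
    (nobleXiT_one_le_tsum_pi_jointWit p x) ?_
  intro a b u v w z t
  fin_cases a <;> fin_cases b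
  exacts [jointWit_cls_0_0 p x u v w z t, jointWit_cls_0_1 p x u v w z t, jointWit_cls_zero_two p x u v w z t,
    jointWit_cls_1_0 p x u v w z t, jointWit_cls_one_one p x u v w z t, jointWit_cls_1_2 p x u v w z t,
    jointWit_cls_2_0 p x u v w z t, jointWit_cls_two_one p x u v w z t, jointWit_cls_two_two p x u v w z t]

/-- **[FvdH17] (6.5) = Lemma 5.2, first display, on the primed element**: `Σ_x Ξ^{(1)}_p(x) ≤ P⃗^S (Ā^ι)' P⃗^E`
(in `[0,∞]`, bond percolation on `ℤ^d`, every `p`).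
[cite: FitznerVanDerHofstad2017, Lemma 5.2 first display and §6.1 (6.5) (arXiv:1506.07977v2 pp. 50, 58)] -/
theorem tsum_nobleXiT_one_le (p : unitInterval) :
    ∑' x, nobleXiT d p 1 x ≤
      vecPS (Letters.perc d p) ᵥ* matAbarIota' (Letters.perc d p) ⬝ᵥ vecPE (Letters.perc d p) :=
  tsum_le_vecPS_matAbarIota'_vecPE (Letters.perc d p) _ (nobleXiT_one_le_blocks p)

/-- The same for the real-valued coefficient `Ξ^{(1)}_p(x) = nobleXiN d p 1 x` (`ofReal ∘ toReal ≤ id`).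
[cite: FitznerVanDerHofstad2017, Lemma 5.2 first display (arXiv:1506.07977v2 p. 50)] -/
theorem tsum_ofReal_nobleXiN_one_le (p : unitInterval) :
    ∑' x, ENNReal.ofReal (nobleXiN d p 1 x) ≤
      vecPS (Letters.perc d p) ᵥ* matAbarIota' (Letters.perc d p) ⬝ᵥ vecPE (Letters.perc d p) :=
  tsum_le_vecPS_matAbarIota'_vecPE (Letters.perc d p) _
    fun x => ENNReal.ofReal_toReal_le.trans (nobleXiT_one_le_blocks p x)

end Literature.Probability.FitznerVanDerHofstad2017

end
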